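/-
Copyright: H21 programme, solo seat `solo-RiemannHypothesis-informed` (session 5).
-/
import Summits.RiemannHypothesis.RiemannHypothesis.Theorems.SoloInformedClusterDodge
import Summits.RiemannHypothesis.RiemannHypothesis.Theorems.SoloInformedEffMain

/-!
# Bounded-cluster visibility: the window (solo-informed, T26–T27)

`SoloInformedClusterDodge` (T25) shows `ε(c + 1) < 0` for an off-line zero `ρ₀ = ½ + η + iγ₀`
whose off-line companions in the height window `|Im ρ − γ₀| < R` form, apart from its partner
`ρ₁ = ½ − η + iγ₀`, a cluster `S'` of size `≤ N`, radius `≤ R₀` and distance `≥ δ` from the pair,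
under the gain condition `K_N(ψ, R₀) log(|γ₀| + 2) < η⁴ δ^{4N} (e^{ηc}Φ(η) − Φ(−η))²`.  Here that
condition is solved for `c`:

* `doubleLog_window_arith`: the arithmetic of the double-log window (the computation of T17),
  packaged once for an arbitrary constant `K`;
* `clusterC0 ψ N R₀ δ η`: the definite offset, `= doubleLogC0`-shape with `K ↦ K_N δ^{−4N}`, i.e.
  `c₀ = max(η⁻¹ log(2Φ(−η)/Φ(η) + 1), (2η)⁻¹ log(4K_N/(η⁴ δ^{4N} Φ(η)²) + 1))`
  — it exceeds the pair offset by `(2N log(1/δ) + N log(1 + R₀²) + O_ψ(log N))/η` only;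
* `weilGroundEnergy_neg_of_local_cluster_window_eff` (**T26**): `|γ₀| ≥ 1`,
  `c ≥ c₀ + log log(|γ₀| + 2)/(2η)`, `R ≥ 1`, `e^{c+1} ≤ R²`, the cluster hypothesis ⟹ `ε(c+1) < 0`;
* `weilGroundEnergy_neg_of_local_cluster_offset_eff` (**T27**): the parameter-free form with the
  plateau bump `ψ₁ = windowPlateau 1` and either sign of `η`;
* `riemannZeta_ne_zero_of_local_cluster_of_weilGroundEnergy_nonneg_eff` (**T27′**, exclusion form):
  Weil positivity at the window `c + 1` plus the cluster hypothesis excludes the zero;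
* `clusterK_le_of_hsw`: on the explicit zero count of Hasanalizade–Shen–Wong (a hypothesis)
  `K_N ≤ 432000 ((1 + R₀²)^N B_{2N+4}(ψ))² + 1`.
-/

open MeasureTheory Complex Set Filter Topology Literature.NumberTheory.LFunctions
open scoped ContDiff

namespace Summit.RiemannHypothesis.RiemannHypothesis.Theorems

/-! ## The double-log window arithmetic, packaged -/

/-- **Window arithmetic** (the computation inside T17).  With `Φ > 0`, `Φm ≥ 0`, `K > 0`, `η > 0`,
`|γ₀| ≥ 1` and `c ≥ max(η⁻¹ log(2Φm/Φ + 1), (2η)⁻¹ log(4K/(η⁴Φ²) + 1)) + log log(|γ₀| + 2)/(2η)`: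
`c ≥ 0`, `Φm ≤ e^{ηc} Φ` and `K log(|γ₀| + 2) < η⁴ (e^{ηc} Φ − Φm)²`. -/
theorem doubleLog_window_arith {K Φ Φm η c γ₀ : ℝ} (hK : 0 < K) (hΦ : 0 < Φ) (hΦm : 0 ≤ Φm)
    (hη : 0 < η) (hγ : 1 ≤ |γ₀|)
    (hc : max (Real.log (2 * Φm / Φ + 1) / η) (Real.log (4 * K / (η ^ 4 * Φ ^ 2) + 1) / (2 * η))
      + Real.log (Real.log (|γ₀| + 2)) / (2 * η) ≤ c) :
    0 ≤ c ∧ Φm ≤ Real.exp (η * c) * Φ ∧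
      K * Real.log (|γ₀| + 2) < η ^ 4 * (Real.exp (η * c) * Φ - Φm) ^ 2 := by
  set c₁ : ℝ := Real.log (2 * Φm / Φ + 1) / η with hc₁_def
  set c₂ : ℝ := Real.log (4 * K / (η ^ 4 * Φ ^ 2) + 1) / (2 * η) with hc₂_def
  have hq1 : 0 < 2 * Φm / Φ + 1 := by positivity
  have hq2 : 0 < 4 * K / (η ^ 4 * Φ ^ 2) + 1 := by positivity
  have hc₁ : 0 ≤ c₁ :=
    div_nonneg (Real.log_nonneg (le_add_of_nonneg_left (by positivity))) hη.le
  have hL : 1 < Real.log (|γ₀| + 2) := by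
    rw [Real.lt_log_iff_exp_lt (by positivity)]
    linarith [Real.exp_one_lt_d9]
  have hL0 : 0 < Real.log (|γ₀| + 2) := by linarith
  have hlogL : 0 < Real.log (Real.log (|γ₀| + 2)) := Real.log_pos hL
  have h2η : 0 < 2 * η := by linarith
  have hcc₁ : c₁ ≤ c := by
    have : 0 ≤ Real.log (Real.log (|γ₀| + 2)) / (2 * η) := by positivity
    linarith [le_max_left c₁ c₂]
  have hcc₂ : c₂ + Real.log (Real.log (|γ₀| + 2)) / (2 * η) ≤ c := by
    linarith [le_max_right c₁ c₂]
  have hc0 : 0 ≤ c := hc₁.trans hcc₁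
  -- (i) the reflected mass is dominated: `2Φm + Φ ≤ e^{ηc} Φ`
  have e1 : Real.exp (η * c₁) = 2 * Φm / Φ + 1 := by
    rw [show η * c₁ = Real.log (2 * Φm / Φ + 1) by rw [hc₁_def]; field_simp, Real.exp_log hq1]
  have i1 : 2 * Φm / Φ + 1 ≤ Real.exp (η * c) :=
    e1 ▸ Real.exp_le_exp.mpr (mul_le_mul_of_nonneg_left hcc₁ hη.le)
  have i1' : 2 * Φm + Φ ≤ Real.exp (η * c) * Φ := by
    have := mul_le_mul_of_nonneg_right i1 hΦ.le
    rwa [add_mul, one_mul, div_mul_cancel₀ _ hΦ.ne'] at this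
  have hdom : Φm ≤ Real.exp (η * c) * Φ := by linarith
  -- (ii) the height condition: `(4K/(η⁴Φ²) + 1)·log(|γ₀|+2) ≤ e^{2ηc}`
  have e2 : Real.exp (2 * η * c₂) = 4 * K / (η ^ 4 * Φ ^ 2) + 1 := by
    rw [show 2 * η * c₂ = Real.log (4 * K / (η ^ 4 * Φ ^ 2) + 1) by rw [hc₂_def]; field_simp,
      Real.exp_log hq2]
  have i2 : (4 * K / (η ^ 4 * Φ ^ 2) + 1) * Real.log (|γ₀| + 2) ≤ Real.exp (2 * η * c) := by
    have step : 2 * η * c₂ + Real.log (Real.log (|γ₀| + 2)) ≤ 2 * η * c := by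
      have e3 : 2 * η * (c₂ + Real.log (Real.log (|γ₀| + 2)) / (2 * η)) =
          2 * η * c₂ + Real.log (Real.log (|γ₀| + 2)) := by
        field_simp
      have := mul_le_mul_of_nonneg_left hcc₂ h2η.le
      linarith [e3]
    calc (4 * K / (η ^ 4 * Φ ^ 2) + 1) * Real.log (|γ₀| + 2)
        = Real.exp (2 * η * c₂ + Real.log (Real.log (|γ₀| + 2))) := by
          rw [Real.exp_add, e2, Real.exp_log hL0]
      _ ≤ Real.exp (2 * η * c) := Real.exp_le_exp.mpr step
  have hpos : 0 < η ^ 4 * Φ ^ 2 := by positivity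
  have i2' : 4 * K * Real.log (|γ₀| + 2) < η ^ 4 * Φ ^ 2 * Real.exp (2 * η * c) := by
    have h := mul_le_mul_of_nonneg_left i2 hpos.le
    have expand : η ^ 4 * Φ ^ 2 * ((4 * K / (η ^ 4 * Φ ^ 2) + 1) * Real.log (|γ₀| + 2)) =
        4 * K * Real.log (|γ₀| + 2) + η ^ 4 * Φ ^ 2 * Real.log (|γ₀| + 2) := by
      field_simp
    rw [expand] at h
    have : 0 < η ^ 4 * Φ ^ 2 * Real.log (|γ₀| + 2) := by positivity
    linarith
  -- (iii) the gain
  set g : ℝ := Real.exp (η * c) * Φ - Φm with hg_def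
  have hg : Real.exp (η * c) * Φ / 2 ≤ g := by rw [hg_def]; linarith
  have hg0 : 0 ≤ Real.exp (η * c) * Φ / 2 := by positivity
  have hg2 : Real.exp (2 * η * c) * Φ ^ 2 / 4 ≤ g ^ 2 := by
    have h := pow_le_pow_left₀ hg0 hg 2
    have e : (Real.exp (η * c) * Φ / 2) ^ 2 = Real.exp (2 * η * c) * Φ ^ 2 / 4 := by
      rw [div_pow, mul_pow, sq (Real.exp _), ← Real.exp_add]; ring_nf
    rwa [e] at h
  have hwin : K * Real.log (|γ₀| + 2) < η ^ 4 * g ^ 2 := by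
    have := mul_le_mul_of_nonneg_left hg2 (by positivity : (0 : ℝ) ≤ η ^ 4)
    linarith
  exact ⟨hc0, hdom, hwin⟩

/-! ## T26: the cluster window -/

variable {ψ : ℝ → ℝ}

/-- The cluster window offset `c₀(ψ, N, R₀, δ, η) =
max(η⁻¹ log(2Φ(−η)/Φ(η) + 1), (2η)⁻¹ log(4 (K_N(ψ, R₀)/δ^{4N})/(η⁴ Φ(η)²) + 1))`,
`Φ = bumpLaplace ψ`, `K_N = clusterK`. -/
noncomputable def clusterC0 (ψ : ℝ → ℝ) (N : ℕ) (R₀ δ η : ℝ) : ℝ :=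
  max (Real.log (2 * bumpLaplace ψ (-η) / bumpLaplace ψ η + 1) / η)
    (Real.log (4 * (clusterK ψ N R₀ / δ ^ (4 * N)) / (η ^ 4 * bumpLaplace ψ η ^ 2) + 1) / (2 * η))

/-- **T26 (bounded-cluster visibility, window form).**  For `ψ ≥ 0` smooth on `[−1, 1]` with
`Φ(η) > 0`, `0 < η < ½`, `0 < δ ≤ 1`: if `|γ₀| ≥ 1`, `c ≥ c₀(ψ, N, R₀, δ, η) + log log(|γ₀| + 2)/(2η)`,
`R ≥ 1`, `e^{c+1} ≤ R²`, `ζ(½ + η + iγ₀) = 0`, and the off-line zeros of the window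
`|Im ρ − γ₀| < R` other than the pair form a cluster `S'` (`|S'| ≤ N`, radius `≤ R₀` about
`½ + iγ₀`, distance `≥ δ` from the pair), then `ε(c + 1) < 0`. -/
theorem weilGroundEnergy_neg_of_local_cluster_window_eff (hψ : ContDiff ℝ ∞ ψ)
    (hsupp : tsupport ψ ⊆ Icc (-1) 1) (hψ0 : ∀ s, 0 ≤ ψ s) {η : ℝ} (hη : 0 < η)
    (hη2 : η < 1 / 2) (hΦ : 0 < bumpLaplace ψ η) (N : ℕ) (R₀ : ℝ) {δ : ℝ} (hδ : 0 < δ)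
    (hδ1 : δ ≤ 1) :
    ∀ (γ₀ c R : ℝ) (S' : Finset ℂ), 1 ≤ |γ₀| →
      clusterC0 ψ N R₀ δ η + Real.log (Real.log (|γ₀| + 2)) / (2 * η) ≤ c → 1 ≤ R →
      Real.exp (c + 1) ≤ R ^ 2 →
      riemannZeta (1 / 2 + η + γ₀ * I) = 0 → S'.card ≤ N →
      (∀ ρ ∈ S', ‖ρ - (1 / 2 + γ₀ * I)‖ ≤ R₀ ∧ δ ≤ ‖ρ - (1 / 2 + η + γ₀ * I)‖ ∧
          δ ≤ ‖ρ - (1 / 2 - η + γ₀ * I)‖) →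
      (∀ ρ : ℂ, riemannZeta ρ = 0 → 0 ≤ ρ.re → ρ.re ≤ 1 → |ρ.im - γ₀| < R → ρ.re ≠ 1 / 2 →
          ρ = 1 / 2 + η + γ₀ * I ∨ ρ = 1 / 2 - η + γ₀ * I ∨ ρ ∈ S') →
      weilGroundEnergy (c + 1) < 0 := by
  intro γ₀ c R S' hγ hc hR hRa hζ hcard hclus hloc
  unfold clusterC0 at hc
  have hδN : 0 < δ ^ (4 * N) := by positivity
  have hKδ : 0 < clusterK ψ N R₀ / δ ^ (4 * N) := div_pos (clusterK_pos ψ N R₀) hδN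
  obtain ⟨hc0, hdom, hwin⟩ :=
    doubleLog_window_arith hKδ hΦ (bumpLaplace_nonneg hψ0 (-η)) hη hγ hc
  have hγ0 : γ₀ ≠ 0 := by intro h; rw [h, abs_zero] at hγ; linarith
  have hwin' : clusterK ψ N R₀ * Real.log (|γ₀| + 2) <
      η ^ 4 * δ ^ (4 * N) *
        (Real.exp (η * c) * bumpLaplace ψ η - bumpLaplace ψ (-η)) ^ 2 := by
    have h := mul_lt_mul_of_pos_left hwin hδN
    have hδne : δ ^ (4 * N) ≠ 0 := hδN.ne'
    have e : δ ^ (4 * N) * (clusterK ψ N R₀ / δ ^ (4 * N) * Real.log (|γ₀| + 2)) =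
        clusterK ψ N R₀ * Real.log (|γ₀| + 2) := by
      field_simp
    rw [e] at h
    calc clusterK ψ N R₀ * Real.log (|γ₀| + 2)
        < δ ^ (4 * N) * (η ^ 4 *
            (Real.exp (η * c) * bumpLaplace ψ η - bumpLaplace ψ (-η)) ^ 2) := h
      _ = η ^ 4 * δ ^ (4 * N) *
            (Real.exp (η * c) * bumpLaplace ψ η - bumpLaplace ψ (-η)) ^ 2 := by ring
  exact weilGroundEnergy_neg_of_local_cluster_eff hψ hsupp hψ0 N R₀ η γ₀ c R δ S' hη hη2 hγ0 hc0
    hR hRa hδ hδ1 hζ hcard hclus hloc hdom hwin'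

/-! ## T27: the parameter-free form (`ψ₁ = windowPlateau 1`, either sign of `η`) -/

/-- **T27 (bounded-cluster visibility, parameter-free).**  With the plateau bump
`ψ₁ = windowPlateau 1` and the definite offset `clusterC0 ψ₁ N R₀ δ |η|`, for either sign of `η`:
`|γ₀| ≥ 1`, `c ≥ c₀ + log log(|γ₀| + 2)/(2|η|)`, `R ≥ 1`, `e^{c+1} ≤ R²`, `ζ(½ + η + iγ₀) = 0` and
the cluster hypothesis ⟹ `ε(c + 1) < 0`. -/
theorem weilGroundEnergy_neg_of_local_cluster_offset_eff {η : ℝ} (hη0 : η ≠ 0)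
    (hη : |η| < 1 / 2) (N : ℕ) (R₀ : ℝ) {δ : ℝ} (hδ : 0 < δ) (hδ1 : δ ≤ 1) :
    ∀ (γ₀ c R : ℝ) (S' : Finset ℂ), 1 ≤ |γ₀| →
      clusterC0 (windowPlateau 1) N R₀ δ |η| + Real.log (Real.log (|γ₀| + 2)) / (2 * |η|) ≤ c →
      1 ≤ R → Real.exp (c + 1) ≤ R ^ 2 →
      riemannZeta (1 / 2 + η + γ₀ * I) = 0 → S'.card ≤ N →
      (∀ ρ ∈ S', ‖ρ - (1 / 2 + γ₀ * I)‖ ≤ R₀ ∧ δ ≤ ‖ρ - (1 / 2 + η + γ₀ * I)‖ ∧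
          δ ≤ ‖ρ - (1 / 2 - η + γ₀ * I)‖) →
      (∀ ρ : ℂ, riemannZeta ρ = 0 → 0 ≤ ρ.re → ρ.re ≤ 1 → |ρ.im - γ₀| < R → ρ.re ≠ 1 / 2 →
          ρ = 1 / 2 + η + γ₀ * I ∨ ρ = 1 / 2 - η + γ₀ * I ∨ ρ ∈ S') →
      weilGroundEnergy (c + 1) < 0 := by
  have hpos : 0 < |η| := abs_pos.mpr hη0
  have hT := weilGroundEnergy_neg_of_local_cluster_window_eff (ψ := windowPlateau 1)
    (contDiff_windowPlateau 1) (tsupport_windowPlateau_subset 1) (windowPlateau_nonneg 1) hpos hη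
    (bumpLaplace_windowPlateau_one_pos |η|) N R₀ hδ hδ1
  intro γ₀ c R S' hγ hc hR hRa hζ hcard hclus hloc
  rcases le_or_gt 0 η with h | h
  · have e : |η| = η := abs_of_nonneg h
    rw [e] at hT hc
    exact hT γ₀ c R S' hγ hc hR hRa hζ hcard hclus hloc
  · have e : |η| = -η := abs_of_neg h
    rw [e] at hT hc
    refine hT γ₀ c R S' hγ hc hR hRa ?_ hcard ?_ ?_
    · push_cast
      rw [show (1 / 2 + -(η : ℂ) + γ₀ * I) = 1 / 2 - η + γ₀ * I by ring]
      exact riemannZeta_zero_reflect hη hζ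
    · intro ρ hρ
      obtain ⟨h1, h2, h3⟩ := hclus ρ hρ
      push_cast
      refine ⟨h1, ?_, ?_⟩
      · rw [show (1 / 2 + -(η : ℂ) + γ₀ * I) = 1 / 2 - η + γ₀ * I by ring]; exact h3
      · rw [show (1 / 2 - -(η : ℂ) + γ₀ * I) = 1 / 2 + η + γ₀ * I by ring]; exact h2
    · intro ρ hz h0 h1 hnear hre
      push_cast
      rw [show (1 / 2 + -(η : ℂ) + γ₀ * I) = 1 / 2 - η + γ₀ * I by ring,
        show (1 / 2 - -(η : ℂ) + γ₀ * I) = 1 / 2 + η + γ₀ * I by ring]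
      rcases hloc ρ hz h0 h1 hnear hre with h' | h' | h'
      · exact Or.inr (Or.inl h')
      · exact Or.inl h'
      · exact Or.inr (Or.inr h')

/-- **T27′ (exclusion form).**  Weil positivity at the window `c + 1` together with the cluster
hypothesis (the off-line zeros of the window other than `½ ± η + iγ₀` form a cluster of size `≤ N`,
radius `≤ R₀`, distance `≥ δ` from the pair) EXCLUDES the zero `½ + η + iγ₀`. -/
theorem riemannZeta_ne_zero_of_local_cluster_of_weilGroundEnergy_nonneg_eff {η : ℝ} (hη0 : η ≠ 0)
    (hη : |η| < 1 / 2) (N : ℕ) (R₀ : ℝ) {δ : ℝ} (hδ : 0 < δ) (hδ1 : δ ≤ 1) :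
    ∀ (γ₀ c R : ℝ) (S' : Finset ℂ), 1 ≤ |γ₀| →
      clusterC0 (windowPlateau 1) N R₀ δ |η| + Real.log (Real.log (|γ₀| + 2)) / (2 * |η|) ≤ c →
      1 ≤ R → Real.exp (c + 1) ≤ R ^ 2 → S'.card ≤ N →
      (∀ ρ ∈ S', ‖ρ - (1 / 2 + γ₀ * I)‖ ≤ R₀ ∧ δ ≤ ‖ρ - (1 / 2 + η + γ₀ * I)‖ ∧
          δ ≤ ‖ρ - (1 / 2 - η + γ₀ * I)‖) →
      (∀ ρ : ℂ, riemannZeta ρ = 0 → 0 ≤ ρ.re → ρ.re ≤ 1 → |ρ.im - γ₀| < R → ρ.re ≠ 1 / 2 →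
          ρ = 1 / 2 + η + γ₀ * I ∨ ρ = 1 / 2 - η + γ₀ * I ∨ ρ ∈ S') →
      0 ≤ weilGroundEnergy (c + 1) →
      riemannZeta (1 / 2 + η + γ₀ * I) ≠ 0 := by
  intro γ₀ c R S' hγ hc hR hRa hcard hclus hloc hE hζ
  have := weilGroundEnergy_neg_of_local_cluster_offset_eff hη0 hη N R₀ hδ hδ1 γ₀ c R S' hγ hc hR
    hRa hζ hcard hclus hloc
  linarith

/-- **The cluster constant is a number** (conditional on the explicit zero count of
Hasanalizade–Shen–Wong, taken as a hypothesis):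
`K_N(ψ, R₀) ≤ 432000 ((1 + R₀²)^N B_{2N+4}(ψ))² + 1`. -/
theorem clusterK_le_of_hsw (h : zetaZeroCount_hasanalizade_shen_wong) (ψ : ℝ → ℝ) (N : ℕ)
    (R₀ : ℝ) :
    clusterK ψ N R₀ ≤ 432000 * ((1 + R₀ ^ 2) ^ N * bumpNormSum ψ (2 * N + 4)) ^ 2 + 1 := by
  unfold clusterK
  have h1 := zetaDensityConst_le_of_hsw h
  have h2 : 0 ≤ ((1 + R₀ ^ 2) ^ N * bumpNormSum ψ (2 * N + 4)) ^ 2 := by positivity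
  nlinarith [mul_le_mul_of_nonneg_right h1 h2]

end Summit.RiemannHypothesis.RiemannHypothesis.Theorems
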